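import Summits.Schanuel.Schanuel.Theorems.ZilberEacParamSurfaceAll
import HarnessLib

/-!
# Polynomially parametrised base curves, XXI: FIBRE CURVES `Q(t, y₀) = 0` over a polynomial curve
# `t ↦ (g₀(t), g₁(t))` — zeros of `Q(t, e^{g₀(t)})` ON A RAY and the escape of `x₁ = g₁(t)`

HONEST FRAMING.  Cell `pub-schanuel` (Zilber's Exponential-Algebraic Closedness, case ladder;
host summit Schanuel), seat 2, gen 20.  After gen 19 (`unprojectedDense_paramSurface₃`: every
irreducible `Q ∈ ℂ[t, y₀, y₁]` with two `y₁`-degrees over a polynomial curve with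
`1 ≤ deg g₀ < deg g₁`), the surfaces `S(g; Q) = {(g₀(t), g₁(t), y₀, y₁) : Q = 0}` of
Mantova–Masser's case over such a curve that remained were the FIBRE CURVES `Q ∈ ℂ[t, y₀]` (no
`y₁`): their exponential points are the zeros of `F(t) = Q(t, e^{g₀(t)})`, which do NOT escape in
`x₀ = g₀(t)` (`|Re g₀| = O(log ‖t‖)` there).  THEOREM (`exists_paramSurface_expPoints_of_y0`,
`unprojectedDense_paramSurface₃_of_y0`): let `d = deg g₀ ≥ 2`, `n = deg g₁ ≥ 1`, and assume the
PHASE CONDITION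

  `d ∤ n`, or `d ∣ n` and `Re( lc(g₁) · (i / lc(g₀))^{n/d} ) ≠ 0`

(for `d = 1` this is gen 17's `Re(lc(p) i^{deg p}) ≠ 0`); let `Q ∈ ℂ[t, y₀]` be irreducible with
two monomials of different `y₀`-degree.  Then the exponential points of `S(g; Q)` are Zariski
dense, `I(S ∩ Γ_exp) = I(S)`.  PROOF: gen 19's directional engine with a logarithmic balance
(`exists_escape_zeros_log_dir`, file XVII) applies VERBATIM with `R = g₀`, NO off-edge term
(`E = 0`), and escape polynomial `G = ± g₁`: it produces zeros `t_k` of `F` on a root direction `ω`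
of `lc(g₀) X^d = ±2πi` with `|Re g₁(t_k)| ≥ L_k → ∞`, `‖g₁(t_k)‖ ≤ A L_k`; the sign of
`Re(lc(g₁) ω^n)` is irrelevant because there is no `E`-term to control, only its NON-VANISHING
matters — and among the `2d` root directions one has `Re(lc(g₁) ω^n) ≠ 0` exactly under the
phase condition (`exists_rootDirection_re_ne_zero`).  THEOREM G in the coordinate `x₁` finishes.
With torus fibres over infinitely many `t` the surface is in the case (dim-π-S-1-free), so
Mantova–Masser's question (PLMS 2024 §1 p. 5, OPEN in general) holds for it
(`unprojectedDensityQuestion_instance_paramSurface₃_of_y0`).  Examples: `{x₀ = y₀², x₁ = y₀³}`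
(= `Q = y₀ - t` over the cusp `(t², t³)`; `e^{t²} = t`).  What stays OPEN here (precisely):
`d ∣ n` with `Re(lc(g₁)(i/lc(g₀))^{n/d}) = 0` (e.g. `(t², i t⁴)`; the analogue of gen 18's
equimodular class — a second-order analysis along the ray), `deg g₀ = 1` is the graph case of gens
17–18, the dictionary lemma for abstract `W` of the case over `C = g(ℂ)`, general algebraic base
curves, Fib(3,2), EC(3,2).  NOT Schanuel's conjecture (neither used nor implied; EAC ⇏ SC).
-/

noncomputable section

open Filter Topology Metric Set Complex MvPolynomial
open Literature.NumberTheory.Transcendental Literature.ModelTheory.Zilber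
open Literature.ModelTheory.ExponentialFields

set_option linter.dupNamespace false

namespace Summit.Schanuel.Schanuel.Theorems

/-! ## Part A. Root directions with a non-vanishing phase -/

/-- `a ω^d = 2πi s`, `0 < d ∣ n` ⟹ `Re(b ω^n) = (2πs)^{n/d} · Re(b (i/a)^{n/d})`. -/
theorem re_mul_rootDirection_pow_of_dvd {a b ω : ℂ} (ha : a ≠ 0) {d n : ℕ} (hd : 0 < d)
    (hdn : d ∣ n) {s : ℤ} (hω : a * ω ^ d = 2 * Real.pi * I * s) :
    (b * ω ^ n).re = (2 * Real.pi * s) ^ (n / d) * (b * (I / a) ^ (n / d)).re := by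
  obtain ⟨q, rfl⟩ := hdn
  have hq : d * q / d = q := Nat.mul_div_cancel_left q hd
  rw [hq, pow_mul]
  have hωd : ω ^ d = 2 * Real.pi * I * s / a := by
    rw [← hω]; field_simp
  rw [hωd]
  have e1 : (2 * (Real.pi : ℂ) * I * s / a) ^ q = (((2 * Real.pi * s : ℝ)) : ℂ) ^ q * (I / a) ^ q := by
    rw [← mul_pow]
    congr 1
    push_cast
    ring
  rw [e1, ← Complex.ofReal_pow, ← mul_assoc, mul_comm b, mul_assoc, Complex.re_ofReal_mul]

/-- **Root directions with a non-vanishing phase, `d ∣ n`.**  `a ≠ 0`, `d ≥ 2`, `d ∣ n`,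
`Re(b (i/a)^{n/d}) ≠ 0` ⟹ there is a root direction `ω` of `a X^d` (`a ω^d = ±2πi`) with
`Re(b ω^n) ≠ 0` (indeed every root direction works). (new) -/
theorem exists_rootDirection_re_ne_zero_of_dvd (a b : ℂ) (ha : a ≠ 0) {d n : ℕ} (hd : 2 ≤ d)
    (hdn : d ∣ n) (hph : (b * (I / a) ^ (n / d)).re ≠ 0) :
    ∃ (ω : ℂ) (s : ℤ), (s = 1 ∨ s = -1) ∧ a * ω ^ d = 2 * Real.pi * I * s ∧
      (b * ω ^ n).re ≠ 0 := by
  obtain ⟨ω, s, hs, hω, -⟩ := exists_rootDirection a ha d hd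
  refine ⟨ω, s, hs, hω, ?_⟩
  rw [re_mul_rootDirection_pow_of_dvd ha (by omega) hdn hω]
  refine mul_ne_zero (pow_ne_zero _ ?_) hph
  have hs0 : (s : ℝ) ≠ 0 := by rcases hs with rfl | rfl <;> norm_num
  exact mul_ne_zero (mul_ne_zero two_ne_zero Real.pi_pos.ne') hs0

/-- **Root directions with a non-vanishing phase** (`d ≥ 2`, `a, b ≠ 0`): under the PHASE
CONDITION `d ∤ n ∨ Re(b (i/a)^{n/d}) ≠ 0` there is a root direction `ω` of `a X^d` with
`Re(b ω^n) ≠ 0`. (new) -/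
theorem exists_rootDirection_re_ne_zero (a b : ℂ) (ha : a ≠ 0) (hb : b ≠ 0) {d n : ℕ}
    (hd : 2 ≤ d) (hph : ¬ d ∣ n ∨ (b * (I / a) ^ (n / d)).re ≠ 0) :
    ∃ (ω : ℂ) (s : ℤ), (s = 1 ∨ s = -1) ∧ a * ω ^ d = 2 * Real.pi * I * s ∧
      (b * ω ^ n).re ≠ 0 := by
  by_cases hdn : d ∣ n
  · exact exists_rootDirection_re_ne_zero_of_dvd a b ha hd hdn (hph.resolve_left (not_not.2 hdn))
  · obtain ⟨ω, s, hs, hω, hre⟩ := exists_rootDirection_re_neg_of_not_dvd a b ha hb hd hdn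
    exact ⟨ω, s, hs, hω, hre.ne⟩

/-! ## Part B. Zeros of `Q(t, e^{g₀(t)})` on a ray with escape of `g₁` -/

/-- `Q(t; y₀, y₁) = Σ_{m ∈ supp Q} (c_m X^{m₀})(t) · y₀^{m₁} · y₁^{m₂}`. -/
theorem eval₃_eq_sum_coeffPoly (Q : MvPolynomial (Fin 3) ℂ) (t y₀ y₁ : ℂ) :
    MvPolynomial.eval ![t, y₀, y₁] Q =
      ∑ m ∈ Q.support, (Polynomial.C (Q.coeff m) * Polynomial.X ^ (m 0)).eval t *
        y₀ ^ (m 1) * y₁ ^ (m 2) := by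
  rw [MvPolynomial.eval_eq']
  refine Finset.sum_congr rfl fun m _ => ?_
  simp only [Fin.prod_univ_three, Matrix.cons_val_zero, Matrix.cons_val_one,
    Matrix.cons_val_two, Matrix.tail_cons, Matrix.head_cons, Polynomial.eval_mul,
    Polynomial.eval_C, Polynomial.eval_pow, Polynomial.eval_X]
  ring

/-- For `Q ∈ ℂ[t, y₀]` (no `y₁`): `Q(t; y₀, y₁) = Σ_m (c_m X^{m₀})(t) · y₀^{m₁}`. -/
theorem eval₃_eq_sum_coeffPoly_of_y0 (Q : MvPolynomial (Fin 3) ℂ)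
    (hQ2 : ∀ m ∈ Q.support, m 2 = 0) (t y₀ y₁ : ℂ) :
    MvPolynomial.eval ![t, y₀, y₁] Q =
      ∑ m ∈ Q.support, (Polynomial.C (Q.coeff m) * Polynomial.X ^ (m 0)).eval t * y₀ ^ (m 1) := by
  rw [eval₃_eq_sum_coeffPoly]
  refine Finset.sum_congr rfl fun m hm => ?_
  rw [hQ2 m hm, pow_zero, mul_one]

/-- **Zeros of `Q(t, e^{g₀(t)})` on a ray, with escape of `g₁`.**  `deg g₀ ≥ 2`, `deg g₁ ≥ 1`,
`Q ∈ ℂ[t, y₀]` (no `y₁`) with two monomials of different `y₀`-degree, `ω` a root direction of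
`lc(g₀) X^{deg g₀}` (`lc(g₀) ω^{deg g₀} = ±2πi`) with `Re(lc(g₁) ω^{deg g₁}) ≠ 0`.  Then there are
`t_k` with `Q(t_k; e^{g₀(t_k)}, e^{g₁(t_k)}) = 0` and `|Re g₁(t_k)| / log(2 + ‖g₁(t_k)‖) → ∞`
(indeed `|Re g₁(t_k)| ≥ L_k → ∞` and `‖g₁(t_k)‖ ≤ A L_k`).  Engine: `exists_escape_zeros_log_dir`
with `R = g₀`, `G = ± g₁`, `E = 0`. (new) -/
theorem exists_paramSurface_expPoints_of_y0 (g₀ g₁ : Polynomial ℂ) (hd : 2 ≤ g₀.natDegree)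
    (hn : 1 ≤ g₁.natDegree) (Q : MvPolynomial (Fin 3) ℂ) (hQ2 : ∀ m ∈ Q.support, m 2 = 0)
    (h1 : ∃ m ∈ Q.support, ∃ m' ∈ Q.support, m 1 ≠ m' 1)
    {ω : ℂ} {σ : ℤ} (hσ : σ = 1 ∨ σ = -1)
    (hω : g₀.leadingCoeff * ω ^ g₀.natDegree = 2 * Real.pi * I * σ)
    (hre : (g₁.leadingCoeff * ω ^ g₁.natDegree).re ≠ 0) :
    ∃ t : ℕ → ℂ, (∀ k, MvPolynomial.eval ![t k, exp (g₀.eval (t k)), exp (g₁.eval (t k))] Q = 0) ∧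
      Tendsto (fun k => |(g₁.eval (t k)).re| / Real.log (2 + ‖g₁.eval (t k)‖)) atTop atTop := by
  classical
  -- coefficient polynomials and exponents
  set q : (Fin 3 →₀ ℕ) → Polynomial ℂ := fun m =>
    Polynomial.C (Q.coeff m) * Polynomial.X ^ (m 0) with hq_def
  set e : (Fin 3 →₀ ℕ) → ℕ := fun m => m 1 with he_def
  have hq_deg : ∀ m ∈ Q.support, (q m).natDegree = m 0 := fun m hm =>
    Polynomial.natDegree_C_mul_X_pow _ _ (MvPolynomial.mem_support_iff.1 hm)
  have hq_lc : ∀ m, (q m).leadingCoeff = Q.coeff m := fun m =>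
    Polynomial.leadingCoeff_C_mul_X_pow _ _
  -- the upper edge of the points `(m₁, m₀)`
  obtain ⟨μ, κ, hκ, ma, hma, mc, hmc, hjne, hja, hjc⟩ := exists_upper_edge Q.support e
    (fun m => m 0) h1
  have hκ' : ∀ m ∈ Q.support, ((q m).natDegree : ℝ) + μ * e m ≤ κ := fun m hm => by
    rw [hq_deg m hm]; exact hκ m hm
  set Jt := Q.support.filter (fun m => ((q m).natDegree : ℝ) + μ * e m = κ) with hJt
  set Qμ : Polynomial ℂ := ∑ m ∈ Jt, Polynomial.C (q m).leadingCoeff * Polynomial.X ^ (e m)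
    with hQμ
  have hmem_top : ∀ {m}, m ∈ Q.support → ((m 0 : ℝ) + μ * e m = κ) → m ∈ Jt := fun {m} hm h =>
    Finset.mem_filter.2 ⟨hm, by rw [hq_deg m hm]; exact h⟩
  have hmaT : ma ∈ Jt := hmem_top hma hja
  have hmcT : mc ∈ Jt := hmem_top hmc hjc
  have hinj : ∀ m ∈ Jt, ∀ m' ∈ Jt, e m = e m' → m = m' := by
    intro m hm m' hm' hee
    obtain ⟨hmM, hmt⟩ := Finset.mem_filter.1 hm
    obtain ⟨hm'M, hm't⟩ := Finset.mem_filter.1 hm'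
    have h0eq : m 0 = m' 0 := by
      rw [hq_deg m hmM] at hmt; rw [hq_deg m' hm'M] at hm't
      rw [hee] at hmt
      have : (m 0 : ℝ) = m' 0 := by linarith
      exact_mod_cast this
    have h1eq : m 1 = m' 1 := hee
    have h2eq : m 2 = m' 2 := by rw [hQ2 m hmM, hQ2 m' hm'M]
    ext i
    fin_cases i
    · exact h0eq
    · exact h1eq
    · exact h2eq
  have hcoeff : ∀ m₁ ∈ Jt, Qμ.coeff (e m₁) = Q.coeff m₁ := by
    intro m₁ hm₁
    rw [hQμ, Polynomial.finsetSum_coeff, Finset.sum_eq_single m₁]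
    · rw [Polynomial.coeff_C_mul, Polynomial.coeff_X_pow, if_pos rfl, mul_one, hq_lc]
    · intro m hm hne
      rw [Polynomial.coeff_C_mul, Polynomial.coeff_X_pow, if_neg, mul_zero]
      exact fun h => hne (hinj m hm m₁ hm₁ h.symm)
    · intro h; exact (h hm₁).elim
  have hca : Qμ.coeff (e ma) ≠ 0 := by
    rw [hcoeff ma hmaT]; exact MvPolynomial.mem_support_iff.1 hma
  have hcc : Qμ.coeff (e mc) ≠ 0 := by
    rw [hcoeff mc hmcT]; exact MvPolynomial.mem_support_iff.1 hmc
  obtain ⟨θ, hθ0, hθ⟩ : ∃ θ : ℂ, θ ≠ 0 ∧ Qμ.eval θ = 0 := by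
    rcases lt_or_gt_of_ne hjne with hlt | hgt
    · exact exists_root_ne_zero_of_coeff_ne_zero (e mc) Qμ (e ma) hlt hca hcc
    · exact exists_root_ne_zero_of_coeff_ne_zero (e ma) Qμ (e mc) hgt hcc hca
  have hQ : Qμ ≠ 0 := fun h => hca (by rw [h, Polynomial.coeff_zero])
  -- no off-edge term
  have hEb : ∀ (G : Polynomial ℂ) (B : ℝ), ∃ C : ℝ, 0 ≤ C ∧ ∃ N : ℕ, ∀ z : ℂ,
      (G.eval z).re ≤ 0 → 1 ≤ ‖z‖ → |(g₀.eval z).re - μ * Real.log ‖z‖| ≤ B →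
        ‖(fun _ : ℂ => (0 : ℂ)) z‖ ≤ C * (1 + ‖z‖) ^ N * Real.exp (1 * (G.eval z).re) :=
    fun G B => ⟨0, le_rfl, 0, fun z _ _ _ => by simp⟩
  -- the engine, with `G = g₁` or `G = -g₁` according to the sign of the phase
  have key : ∀ G : Polynomial ℂ, 1 ≤ G.natDegree → (G.leadingCoeff * ω ^ G.natDegree).re < 0 →
      ∃ (t : ℕ → ℂ) (L : ℕ → ℝ) (A : ℝ), Tendsto L atTop atTop ∧
        ∀ k, MvPolynomial.eval ![t k, exp (g₀.eval (t k)), exp (g₁.eval (t k))] Q = 0 ∧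
          (G.eval (t k)).re ≤ -L k ∧ ‖G.eval (t k)‖ ≤ A * L k := by
    intro G hG hGre
    obtain ⟨t, L, A, hL, ht⟩ := exists_escape_zeros_log_dir g₀ G hd hG Q.support q e μ κ hκ'
      hθ0 hθ hQ ω σ hσ hω hGre (fun _ => 0) (differentiable_const 0) zero_lt_one (hEb G)
    refine ⟨t, L, A, hL, fun k => ⟨?_, (ht k).2.1, (ht k).2.2⟩⟩
    rw [eval₃_eq_sum_coeffPoly_of_y0 Q hQ2]
    have h := (ht k).1
    rw [add_zero] at h
    simpa only [hq_def, he_def, ← Complex.exp_nat_mul, Polynomial.eval_mul, Polynomial.eval_C,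
      Polynomial.eval_pow, Polynomial.eval_X] using h
  rcases hre.lt_or_gt with hlt | hgt
  · obtain ⟨t, L, A, hL, ht⟩ := key g₁ hn hlt
    exact ⟨t, fun k => (ht k).1, tendsto_abs_re_div_log_of_escape hL (fun k => (ht k).2.1)
      (fun k => (ht k).2.2)⟩
  · have hn' : 1 ≤ (-g₁).natDegree := by rwa [Polynomial.natDegree_neg]
    have hlt' : ((-g₁).leadingCoeff * ω ^ (-g₁).natDegree).re < 0 := by
      rw [Polynomial.leadingCoeff_neg, Polynomial.natDegree_neg, neg_mul, Complex.neg_re]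
      linarith
    obtain ⟨t, L, A, hL, ht⟩ := key (-g₁) hn' hlt'
    refine ⟨t, fun k => (ht k).1, ?_⟩
    have h := tendsto_abs_re_div_log_of_escape hL (fun k => (ht k).2.1) (fun k => (ht k).2.2)
    refine h.congr fun k => ?_
    simp only [Polynomial.eval_neg, Complex.neg_re, abs_neg, norm_neg]

/-! ## Part C. Density from exponential points escaping in `x₁` -/

/-- **Density from exponential points escaping in the coordinate `x₁`** (surfaces over a
polynomial curve; THEOREM G in `x₁`). (new) -/
theorem unprojectedDense_paramSurface₃_of_expPoints₁ (g₀ g₁ : Polynomial ℂ)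
    (Q : MvPolynomial (Fin 3) ℂ) {t : ℕ → ℂ}
    (ht : ∀ k, MvPolynomial.eval ![t k, exp (g₀.eval (t k)), exp (g₁.eval (t k))] Q = 0)
    (hgr : Tendsto (fun k => |(g₁.eval (t k)).re| / Real.log (2 + ‖g₁.eval (t k)‖)) atTop atTop)
    (hS : IsIrreducibleClosed ℂ {w : Fin 2 ⊕ Fin 2 → ℂ | ∃ t : ℂ, w (Sum.inl 0) = g₀.eval t ∧
      w (Sum.inl 1) = g₁.eval t ∧
      MvPolynomial.eval (Fin.cases t (fun i => w (Sum.inr i)) : Fin 3 → ℂ) Q = 0})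
    (hdim : zariskiDim ℂ {w : Fin 2 ⊕ Fin 2 → ℂ | ∃ t : ℂ, w (Sum.inl 0) = g₀.eval t ∧
      w (Sum.inl 1) = g₁.eval t ∧
      MvPolynomial.eval (Fin.cases t (fun i => w (Sum.inr i)) : Fin 3 → ℂ) Q = 0} ≤ (2 : ℕ)) :
    UnprojectedDense {w : Fin 2 ⊕ Fin 2 → ℂ | ∃ t : ℂ, w (Sum.inl 0) = g₀.eval t ∧
      w (Sum.inl 1) = g₁.eval t ∧
      MvPolynomial.eval (Fin.cases t (fun i => w (Sum.inr i)) : Fin 3 → ℂ) Q = 0} := by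
  set q : ℕ → Fin 2 ⊕ Fin 2 → ℂ := fun k =>
    Sum.elim ![g₀.eval (t k), g₁.eval (t k)] ![exp (g₀.eval (t k)), exp (g₁.eval (t k))] with hq
  have hqS : ∀ k, q k ∈ {w : Fin 2 ⊕ Fin 2 → ℂ | ∃ t : ℂ, w (Sum.inl 0) = g₀.eval t ∧
      w (Sum.inl 1) = g₁.eval t ∧
      MvPolynomial.eval (Fin.cases t (fun i => w (Sum.inr i)) : Fin 3 → ℂ) Q = 0} := by
    intro k
    refine ⟨t k, by simp [hq], by simp [hq], ?_⟩
    have e : (Fin.cases (t k) (fun i => q k (Sum.inr i)) : Fin 3 → ℂ) =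
        ![t k, exp (g₀.eval (t k)), exp (g₁.eval (t k))] := by
      funext i
      refine Fin.cases ?_ (fun j => ?_) i
      · rfl
      · simp only [Fin.cases_succ]
        fin_cases j <;> simp [hq]
    rw [e]; exact ht k
  have hqΓ : ∀ k, q k ∈ expGraph ℂ 2 := by
    intro k
    rw [mem_expGraph_iff]
    intro i
    rw [Literature.ModelTheory.ExponentialFields.ExponentialRing.complex_exp_eq]
    fin_cases i <;> simp [hq]
  have hgr' : Tendsto (fun k => |(q k (Sum.inl 1)).re| / Real.log (2 + ‖q k (Sum.inl 1)‖))
      atTop atTop := by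
    refine hgr.congr fun k => ?_
    simp [hq]
  exact unprojectedDense_of_growth hS hdim 1 hqS hqΓ hgr'

/-! ## Part D. The density theorems for fibre curves over polynomial curves -/

section Main

variable (g₀ g₁ : Polynomial ℂ) {Q : MvPolynomial (Fin 3) ℂ}

/-- **Density for fibre curves over a polynomial curve, given a root direction with non-vanishing
phase.**  `deg g₀ ≥ 2`, `deg g₁ ≥ 1`, `lc(g₀) ω^{deg g₀} = ±2πi`, `Re(lc(g₁) ω^{deg g₁}) ≠ 0`;
`Q ∈ ℂ[t, y₀]` irreducible with two monomials of different `y₀`-degree ⟹ the exponential points of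
`S(g; Q) = {(g₀(t), g₁(t), y₀, y₁) : Q(t, y₀) = 0}` are Zariski dense.
[cite: MantovaMasser2023, §1 Further remarks, p. 5 (the question, open in general)] (new) -/
theorem unprojectedDense_paramSurface₃_of_y0_of_dir (hd : 2 ≤ g₀.natDegree)
    (hn : 1 ≤ g₁.natDegree) (hirr : Irreducible Q) (hQ2 : ∀ m ∈ Q.support, m 2 = 0)
    (h1 : ∃ m ∈ Q.support, ∃ m' ∈ Q.support, m 1 ≠ m' 1)
    {ω : ℂ} {σ : ℤ} (hσ : σ = 1 ∨ σ = -1)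
    (hω : g₀.leadingCoeff * ω ^ g₀.natDegree = 2 * Real.pi * I * σ)
    (hre : (g₁.leadingCoeff * ω ^ g₁.natDegree).re ≠ 0) :
    UnprojectedDense {w : Fin 2 ⊕ Fin 2 → ℂ | ∃ t : ℂ, w (Sum.inl 0) = g₀.eval t ∧
      w (Sum.inl 1) = g₁.eval t ∧
      MvPolynomial.eval (Fin.cases t (fun i => w (Sum.inr i)) : Fin 3 → ℂ) Q = 0} := by
  have hg₀ : 1 ≤ g₀.natDegree := by omega
  obtain ⟨t, ht, hgr⟩ := exists_paramSurface_expPoints_of_y0 g₀ g₁ hd hn Q hQ2 h1 hσ hω hre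
  exact unprojectedDense_paramSurface₃_of_expPoints₁ g₀ g₁ Q ht hgr
    (isIrreducibleClosed_paramSurface₃ g₀ g₁ hg₀ hirr)
    (by rw [zariskiDim_paramSurface₃ g₀ g₁ hg₀ hirr])

/-- **MAIN THEOREM (fibre curves over a polynomial curve).**  `d = deg g₀ ≥ 2`, `n = deg g₁ ≥ 1`,
PHASE CONDITION `d ∤ n ∨ Re(lc(g₁) (i/lc(g₀))^{n/d}) ≠ 0`; `Q ∈ ℂ[t, y₀]` (no `y₁`) irreducible with
two monomials of different `y₀`-degree ⟹ the exponential points of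
`S(g; Q) = {(g₀(t), g₁(t), y₀, y₁) : Q(t, y₀) = 0} ⊆ ℂ² × ℂ²` are Zariski dense.
[cite: MantovaMasser2023, §1 Further remarks, p. 5 (the question, open in general)] (new) -/
theorem unprojectedDense_paramSurface₃_of_y0 (hd : 2 ≤ g₀.natDegree) (hn : 1 ≤ g₁.natDegree)
    (hph : ¬ g₀.natDegree ∣ g₁.natDegree ∨
      (g₁.leadingCoeff * (I / g₀.leadingCoeff) ^ (g₁.natDegree / g₀.natDegree)).re ≠ 0)
    (hirr : Irreducible Q) (hQ2 : ∀ m ∈ Q.support, m 2 = 0)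
    (h1 : ∃ m ∈ Q.support, ∃ m' ∈ Q.support, m 1 ≠ m' 1) :
    UnprojectedDense {w : Fin 2 ⊕ Fin 2 → ℂ | ∃ t : ℂ, w (Sum.inl 0) = g₀.eval t ∧
      w (Sum.inl 1) = g₁.eval t ∧
      MvPolynomial.eval (Fin.cases t (fun i => w (Sum.inr i)) : Fin 3 → ℂ) Q = 0} := by
  have hg0 : g₀ ≠ 0 := by rintro rfl; rw [Polynomial.natDegree_zero] at hd; omega
  have hg1 : g₁ ≠ 0 := by rintro rfl; rw [Polynomial.natDegree_zero] at hn; omega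
  obtain ⟨ω, σ, hσ, hω, hre⟩ := exists_rootDirection_re_ne_zero g₀.leadingCoeff g₁.leadingCoeff
    (Polynomial.leadingCoeff_ne_zero.2 hg0) (Polynomial.leadingCoeff_ne_zero.2 hg1) hd hph
  exact unprojectedDense_paramSurface₃_of_y0_of_dir g₀ g₁ hd hn hirr hQ2 h1 hσ hω hre

/-- **Case certificate for fibre curves over a polynomial curve.**  `deg g₀ ≥ 1`, the pair
`(g₀, g₁)` without linear relations `m₀ g₀ + m₁ g₁ = c` (`m ∈ ℤ² ∖ 0`), `Q` irreducible with a
fibre zero `Q(t; y, 1) = 0`, `y ≠ 0`, for infinitely many `t` (for `Q ∈ ℂ[t, y₀]`: a nonzero fibre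
root) ⟹ `S(g; Q)` is in Mantova–Masser's case (dim-π-S-1-free). (new) -/
theorem mmCase_paramSurface₃_of_y0 (hg₀ : 1 ≤ g₀.natDegree)
    (hindep : ∀ m : Fin 2 → ℤ, m ≠ 0 → ∀ c : ℂ,
      Polynomial.C (m 0 : ℂ) * g₀ + Polynomial.C (m 1 : ℂ) * g₁ ≠ Polynomial.C c)
    (hirr : Irreducible Q)
    (hfib : Set.Infinite {t : ℂ | ∃ y : ℂ, y ≠ 0 ∧ MvPolynomial.eval ![t, y, 1] Q = 0}) :
    MMCaseDimPiOneFree {w : Fin 2 ⊕ Fin 2 → ℂ | ∃ t : ℂ, w (Sum.inl 0) = g₀.eval t ∧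
        w (Sum.inl 1) = g₁.eval t ∧
        MvPolynomial.eval (Fin.cases t (fun i => w (Sum.inr i)) : Fin 3 → ℂ) Q = 0} := by
  refine mmCase_paramSurface₃ g₀ g₁ hg₀ hindep hirr (hfib.mono ?_)
  rintro t ⟨y, hy, hty⟩
  exact ⟨![y, 1], by simpa using hy, by simp, by simpa using hty⟩

/-- **Mantova–Masser's question for fibre curves over a polynomial curve: case ∧ dense.**
`d = deg g₀ ≥ 2`, `n = deg g₁ ≥ 1`, phase condition, `Q ∈ ℂ[t, y₀]` irreducible with two
`y₀`-degrees and a nonzero fibre root over infinitely many `t` ⟹ `S(g; Q)` is in the case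
(dim-π-S-1-free) AND its exponential points are Zariski dense.
[cite: MantovaMasser2023, §1 Further remarks, p. 5 (the question, open in general)] (new) -/
theorem unprojectedDensityQuestion_instance_paramSurface₃_of_y0 (hd : 2 ≤ g₀.natDegree)
    (hn : 1 ≤ g₁.natDegree)
    (hph : ¬ g₀.natDegree ∣ g₁.natDegree ∨
      (g₁.leadingCoeff * (I / g₀.leadingCoeff) ^ (g₁.natDegree / g₀.natDegree)).re ≠ 0)
    (hirr : Irreducible Q) (hQ2 : ∀ m ∈ Q.support, m 2 = 0)
    (h1 : ∃ m ∈ Q.support, ∃ m' ∈ Q.support, m 1 ≠ m' 1)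
    (hfib : Set.Infinite {t : ℂ | ∃ y : ℂ, y ≠ 0 ∧ MvPolynomial.eval ![t, y, 1] Q = 0}) :
    MMCaseDimPiOneFree {w : Fin 2 ⊕ Fin 2 → ℂ | ∃ t : ℂ, w (Sum.inl 0) = g₀.eval t ∧
        w (Sum.inl 1) = g₁.eval t ∧
        MvPolynomial.eval (Fin.cases t (fun i => w (Sum.inr i)) : Fin 3 → ℂ) Q = 0} ∧
      UnprojectedDense {w : Fin 2 ⊕ Fin 2 → ℂ | ∃ t : ℂ, w (Sum.inl 0) = g₀.eval t ∧
        w (Sum.inl 1) = g₁.eval t ∧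
        MvPolynomial.eval (Fin.cases t (fun i => w (Sum.inr i)) : Fin 3 → ℂ) Q = 0} := by
  refine ⟨mmCase_paramSurface₃_of_y0 g₀ g₁ (by omega) ?_ hirr hfib,
    unprojectedDense_paramSurface₃_of_y0 g₀ g₁ hd hn hph hirr hQ2 h1⟩
  by_cases hne : g₀.natDegree = g₁.natDegree
  · -- equal degrees: the phase condition says `Im(lc(g₁)/lc(g₀)) ≠ 0`
    have hdvd : g₀.natDegree ∣ g₁.natDegree := hne ▸ dvd_rfl
    have hph' := hph.resolve_left (not_not.2 hdvd)
    rw [hne, Nat.div_self (by omega), pow_one] at hph'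
    have him : (g₁.leadingCoeff / g₀.leadingCoeff).im ≠ 0 := by
      intro h0
      apply hph'
      rw [show g₁.leadingCoeff * (I / g₀.leadingCoeff) = (g₁.leadingCoeff / g₀.leadingCoeff) * I
        by ring, Complex.mul_I_re, h0, neg_zero]
    exact paramCurve_indep_of_im_ne_zero g₀ g₁ (by omega) hne.symm him
  · exact paramCurve_indep_of_ne g₀ g₁ (by omega) hn hne

end Main

end Summit.Schanuel.Schanuel.Theorems
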